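import Literature.Barriers.QuantumFields.NoClassicalGlueballsDecay
import Literature.Barriers.QuantumFields.NoClassicalGlueballsTraceForm
import Literature.MathematicalPhysics.QuantumLattice.YangMillsClassicalProofs
import HarnessLib

/-!
# No classical glueballs: Coleman's argument and the discharge (proofs, part 4)

Sibling proof file of `Literature/Barriers/QuantumFields/NoClassicalGlueballs.lean`, last of the
files discharging the named fact `ColemanNoClassicalGlueballs` (Coleman 1977):
`theorem ColemanNoClassicalGlueballs_holds : ColemanNoClassicalGlueballs`.

## The argument (Coleman §2, (11)–(15))

Under `ColemanHypotheses 𝔤 B A` let `E` be the (conserved, part 3) energy at positive times and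
suppose `E > 0`. With the cutoff `χ_r` (`≡ 1` on `|y| ≤ r`, supported in `|y| ≤ 2r`,
`|∇χ_r| ≤ C/r`) put `P(t) = Σ_i ∫ χ_r(y) yⁱ θ_{0i}(t, y) dy` (Coleman's `F(r,t) = −∫_{|x|≤r} xⁱθ_{0i}`,
(11), smoothed). By the transport lemma and momentum conservation `∂₀θ_{0i} = Σ_j ∂_jθ_{ji}`,
`P'(t) = −∫ χ_r θ_{ii} − Σ_{ij} ∫ yⁱ ∂_jχ_r θ_{ji} = −∫ χ_r θ₀₀ − (shell terms)` (tracelessness (5);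
this is (12)), and by (10) the shell terms and `E − ∫ χ_r θ₀₀` are `O(r^{-1/4})` uniformly in
`t > 0`; so for `r` large `P'(t) ≤ −E/2` for all `t > 0` ((13)–(14)), while
`|P(t)| ≤ 30 r E` from `|yⁱθ_{0i}| ≤ 2r · 5θ₀₀` on the support ((9), (15)) — a contradiction for
large `t`. Hence `E = 0`, so `θ₀₀(t, ·) ≡ 0` for `t > 0` (continuity), all `F_{μν}` vanish there,
and `F_A(x)(u, v) = 0` for `x⁰ > 0` by bilinearity (`ColemanHypotheses.curvature_eq_zero`).

Finally the compact case of the fact: on `M_N(ℂ)` with the (scoped) Frobenius norm the real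
trace form `⟨X, Y⟩ = Re tr(Xᴴ Y)` of the sibling file `NoClassicalGlueballsTraceForm.lean`
(`traceFormL`, with `isInvariantForm_traceFormL`) is an invariant positive form for
`𝔲(N) = skewAdjoint.submodule ℝ M_N(ℂ)`, so every `IsClassicalGlueball A` satisfies Coleman's
hypotheses (`IsClassicalGlueball.colemanHypotheses`) and has `F ≡ 0` at positive times,
contradicting its last clause: `ColemanNoClassicalGlueballs_holds`.

## References

* S. Coleman, *There are no classical glueballs*, Commun. Math. Phys. 55 (1977) 113–116, §2
  (9), (11)–(15) [Coleman1977].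
* R. T. Glassey, W. A. Strauss, *Decay of classical Yang–Mills fields*, Commun. Math. Phys. 65
  (1979) 1–13, §3 (p_j), §1 ("there are no classical lumps") [GlasseyStrauss1979].
-/

noncomputable section

open scoped ContDiff
open MeasureTheory Set Filter Topology Function Metric

namespace Literature.Barriers.QuantumFields

open Literature.MathematicalPhysics.QuantumLattice Literature.Analysis.FluidPDE

variable {𝔸 : Type*} [NormedRing 𝔸] [NormedAlgebra ℝ 𝔸]

namespace ColemanHypotheses

variable {𝔤 : Submodule ℝ 𝔸} {B : 𝔸 →L[ℝ] 𝔸 →L[ℝ] ℝ} {A : Connection (SpaceTime 3) 𝔸}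

/-! ### Coleman's weighted momentum `P(t) = Σ_i ∫ χ_r yⁱ θ_{0i}` -/

/-- The weights `ψ_i(y) = χ_r(y) yⁱ` are smooth. [folklore] -/
theorem contDiff_cutoff_mul_coord (r : ℝ) (i : Fin 3) {n : ℕ∞} :
    ContDiff ℝ n fun y : EuclideanSpace ℝ (Fin 3) => cutoff r y * y i :=
  (contDiff_cutoff r).mul (EuclideanSpace.proj (𝕜 := ℝ) i).contDiff

/-- The weights `ψ_i(y) = χ_r(y) yⁱ` have compact support (`r > 0`). [folklore] -/
theorem hasCompactSupport_cutoff_mul_coord {r : ℝ} (hr : 0 < r) (i : Fin 3) :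
    HasCompactSupport fun y : EuclideanSpace ℝ (Fin 3) => cutoff r y * y i :=
  (hasCompactSupport_cutoff hr).mul_right

/-- `|χ_r(y) yⁱ| ≤ 2r`. [folklore] -/
theorem abs_cutoff_mul_coord_le {r : ℝ} (hr : 0 < r) (i : Fin 3) (y : EuclideanSpace ℝ (Fin 3)) :
    |cutoff r y * y i| ≤ 2 * r := by
  have hyi : |y i| ≤ ‖y‖ := by simpa using PiLp.norm_apply_le y i
  by_cases hy : 2 * r ≤ ‖y‖
  · rw [cutoff_eq_zero hr hy, zero_mul, abs_zero]; linarith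
  · rw [abs_mul, abs_of_nonneg (cutoff_nonneg r y)]
    calc cutoff r y * |y i| ≤ 1 * |y i| :=
          mul_le_mul_of_nonneg_right (cutoff_le_one r y) (abs_nonneg _)
      _ ≤ 2 * r := by linarith [not_le.1 hy]

/-- The gradient of the weights: `∂_j(χ_r yⁱ) = χ_r δ_{ij} + yⁱ ∂_jχ_r`. [folklore] -/
theorem fderiv_cutoff_mul_coord (r : ℝ) (i j : Fin 3) (y : EuclideanSpace ℝ (Fin 3)) :
    fderiv ℝ (fun z : EuclideanSpace ℝ (Fin 3) => cutoff r z * z i) y (EuclideanSpace.single j 1) =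
      (if i = j then cutoff r y else 0) +
        y i * fderiv ℝ (cutoff r) y (EuclideanSpace.single j 1) := by
  have h1 : DifferentiableAt ℝ (cutoff r) y :=
    (contDiff_cutoff (n := 1) r).differentiable one_ne_zero y
  have h2 : DifferentiableAt ℝ (fun z : EuclideanSpace ℝ (Fin 3) => z i) y :=
    (EuclideanSpace.proj (𝕜 := ℝ) i).differentiableAt
  rw [fderiv_fun_mul h1 h2]
  have h3 : fderiv ℝ (fun z : EuclideanSpace ℝ (Fin 3) => z i) y = EuclideanSpace.proj (𝕜 := ℝ) i :=
    (EuclideanSpace.proj (𝕜 := ℝ) i).fderiv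
  rw [add_apply, smul_apply, smul_apply, h3, smul_eq_mul, smul_eq_mul]
  have h4 : (EuclideanSpace.proj (𝕜 := ℝ) i) (EuclideanSpace.single j (1 : ℝ)) =
      if i = j then 1 else 0 := by
    show (EuclideanSpace.single j (1 : ℝ)) i = _
    rw [PiLp.single_apply]
  rw [h4]
  split_ifs <;> ring

/-- `|yⁱ ∂_jχ_r(y)| ≤ 2C` (the gradient lives in `r ≤ |y| ≤ 2r`, where `|yⁱ| ≤ 2r` and
`|∇χ_r| ≤ C/r`). [folklore] -/
theorem abs_coord_mul_fderiv_cutoff_le {r : ℝ} (hr : 0 < r) (i j : Fin 3)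
    (y : EuclideanSpace ℝ (Fin 3)) :
    |y i * fderiv ℝ (cutoff r) y (EuclideanSpace.single j 1)| ≤ 2 * cutoffGradConst := by
  have hC := cutoffGradConst_spec.1
  have hyi : |y i| ≤ ‖y‖ := by simpa using PiLp.norm_apply_le y i
  by_cases hy : 2 * r < ‖y‖
  · rw [fderiv_cutoff_eq_zero_of_lt_norm hr hy]; simp; positivity
  · rw [abs_mul]
    calc |y i| * |fderiv ℝ (cutoff r) y (EuclideanSpace.single j 1)|
        ≤ (2 * r) * (cutoffGradConst / r) :=
          mul_le_mul (by linarith [not_lt.1 hy]) (abs_fderiv_cutoff_single_le hr y j)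
            (abs_nonneg _) (by linarith)
      _ = 2 * cutoffGradConst := by field_simp

/-- **`P` is differentiable** with
`P'(t) = −Σ_i Σ_j ∫ ∂_j(χ_r yⁱ) θ_{j+1,i+1}(t, ·)` (transport lemma with momentum conservation
`∂₀θ_{0i} = Σ_j ∂_jθ_{ji}`). [cite: Coleman1977, §2 (4), (11)–(12)] -/
theorem hasDerivAt_weightedMomentum (h : ColemanHypotheses 𝔤 B A) {r : ℝ} (hr : 0 < r) (t : ℝ) :
    HasDerivAt (fun s => ∑ i : Fin 3, ∫ y, (cutoff r y * y i) *
        stressTensor B A 0 i.succ (ofTimeSpace s y))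
      (∑ i : Fin 3, -(∑ j : Fin 3, ∫ y,
        fderiv ℝ (fun z : EuclideanSpace ℝ (Fin 3) => cutoff r z * z i) y (EuclideanSpace.single j 1) *
          stressTensor B A j.succ i.succ (ofTimeSpace t y))) t :=
  HasDerivAt.fun_sum fun i _ =>
    hasDerivAt_integral_mul_slice (contDiff_stressTensor h.smooth 0 i.succ)
      (fun j => contDiff_stressTensor h.smooth j.succ i.succ)
      (fun x => fderiv_stressTensor_zero h.form h.valuedIn h.smooth h.solution i.succ x)
      (contDiff_cutoff_mul_coord r i) (hasCompactSupport_cutoff_mul_coord hr i) t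

/-- **Coleman's (12): the derivative of `P` is `−∫ χ_r θ₀₀ −` (shell terms).** For every `t`,
`P'(t) = −∫ χ_r θ₀₀(t,·) − Σ_{ij} ∫ yⁱ ∂_jχ_r θ_{j+1,i+1}(t,·)` (product rule for the weight and
the trace identity `Σ_i θ_{ii} = θ₀₀`). [cite: Coleman1977, §2 (5), (12)] -/
theorem deriv_weightedMomentum_eq (h : ColemanHypotheses 𝔤 B A) {r : ℝ} (hr : 0 < r) (t : ℝ) :
    (∑ i : Fin 3, -(∑ j : Fin 3, ∫ y,
        fderiv ℝ (fun z : EuclideanSpace ℝ (Fin 3) => cutoff r z * z i) y (EuclideanSpace.single j 1) *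
          stressTensor B A j.succ i.succ (ofTimeSpace t y))) =
      -(∫ y, cutoff r y * stressTensor B A 0 0 (ofTimeSpace t y)) -
        ∑ i : Fin 3, ∑ j : Fin 3, ∫ y, (y i * fderiv ℝ (cutoff r) y (EuclideanSpace.single j 1)) *
          stressTensor B A j.succ i.succ (ofTimeSpace t y) := by
  -- continuity of the slices of `θ`
  have hθc : ∀ μ ν, Continuous fun y : EuclideanSpace ℝ (Fin 3) =>
      stressTensor B A μ ν (ofTimeSpace t y) := fun μ ν =>
    (contDiff_stressTensor h.smooth μ ν).continuous.comp
      (contDiff_ofTimeSpace_right t (n := 0)).continuous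
  have hχc : Continuous (cutoff r : EuclideanSpace ℝ (Fin 3) → ℝ) :=
    (contDiff_cutoff (n := 0) r).continuous
  have hχs : HasCompactSupport (cutoff r : EuclideanSpace ℝ (Fin 3) → ℝ) :=
    hasCompactSupport_cutoff hr
  have hdχc : ∀ j : Fin 3, Continuous fun y : EuclideanSpace ℝ (Fin 3) =>
      fderiv ℝ (cutoff r) y (EuclideanSpace.single j 1) := fun j =>
    ((contDiff_cutoff (n := 1) r).continuous_fderiv one_ne_zero).clm_apply continuous_const
  have hdχs : ∀ j : Fin 3, HasCompactSupport fun y : EuclideanSpace ℝ (Fin 3) =>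
      fderiv ℝ (cutoff r) y (EuclideanSpace.single j 1) := fun j =>
    hχs.fderiv_apply (𝕜 := ℝ) _
  -- split each integral with the product rule for the weight
  have hsplit : ∀ i j : Fin 3, ∫ y,
      fderiv ℝ (fun z : EuclideanSpace ℝ (Fin 3) => cutoff r z * z i) y (EuclideanSpace.single j 1) *
        stressTensor B A j.succ i.succ (ofTimeSpace t y) =
      (if i = j then ∫ y, cutoff r y * stressTensor B A j.succ i.succ (ofTimeSpace t y) else 0) +
        ∫ y, (y i * fderiv ℝ (cutoff r) y (EuclideanSpace.single j 1)) *
          stressTensor B A j.succ i.succ (ofTimeSpace t y) := by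
    intro i j
    simp_rw [fderiv_cutoff_mul_coord r i j, add_mul]
    have hint2 : Integrable fun y : EuclideanSpace ℝ (Fin 3) =>
        (y i * fderiv ℝ (cutoff r) y (EuclideanSpace.single j 1)) *
          stressTensor B A j.succ i.succ (ofTimeSpace t y) :=
      (((EuclideanSpace.proj (𝕜 := ℝ) i).continuous.mul (hdχc j)).mul (hθc _ _))
        |>.integrable_of_hasCompactSupport ((hdχs j).mul_left.mul_right)
    split_ifs with hij
    · have hint1 : Integrable fun y : EuclideanSpace ℝ (Fin 3) =>
          cutoff r y * stressTensor B A j.succ i.succ (ofTimeSpace t y) :=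
        (hχc.mul (hθc _ _)).integrable_of_hasCompactSupport hχs.mul_right
      rw [integral_add hint1 hint2]
    · simp only [zero_mul, zero_add]
  simp_rw [hsplit, Finset.sum_add_distrib, Finset.sum_ite_eq, Finset.mem_univ, if_true,
    neg_add, Finset.sum_add_distrib, Finset.sum_neg_distrib]
  -- the trace identity under the integral
  have htrace : ∑ i : Fin 3, ∫ y, cutoff r y * stressTensor B A i.succ i.succ (ofTimeSpace t y) =
      ∫ y, cutoff r y * stressTensor B A 0 0 (ofTimeSpace t y) := by
    have hint : ∀ i : Fin 3, Integrable fun y : EuclideanSpace ℝ (Fin 3) =>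
        cutoff r y * stressTensor B A i.succ i.succ (ofTimeSpace t y) := fun i =>
      (hχc.mul (hθc _ _)).integrable_of_hasCompactSupport hχs.mul_right
    rw [← integral_finsetSum _ fun i _ => hint i]
    refine integral_congr_ae (ae_of_all _ fun y => ?_)
    show ∑ i : Fin 3, cutoff r y * stressTensor B A i.succ i.succ (ofTimeSpace t y) =
      cutoff r y * stressTensor B A 0 0 (ofTimeSpace t y)
    rw [stressTensor_trace (B := B) (A := A) (ofTimeSpace t y), Finset.mul_sum]
  rw [htrace]
  ring

/-- **(13): `P'(t) ≤ −E(t) + K r^{-1/4}` for `t > 0`, `r ≥ R₀`,** with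
`K = (1 + 90 C) ‖g‖₁`: the shell terms are bounded by `9 · 2C · 5 r^{-1/4} ‖g‖₁` and
`∫ χ_r θ₀₀ ≥ E − ‖g‖₁ r^{-1/4}`. [cite: Coleman1977, §2 (12)–(13)] -/
theorem deriv_weightedMomentum_le (h : ColemanHypotheses 𝔤 B A) {R₀ : ℝ} (hR₀1 : 1 ≤ R₀)
    (hR₀ : ∀ t : ℝ, 0 < t → ∀ r : ℝ, R₀ ≤ r → ∀ y : EuclideanSpace ℝ (Fin 3),
      r ≤ ‖y‖ → ymEnergyDensity A (ofTimeSpace t y) ≤ r ^ (-(1 / 4 : ℝ)) * energyMajorant y)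
    {t : ℝ} (ht : 0 < t) {r : ℝ} (hr : R₀ ≤ r) :
    (∑ i : Fin 3, -(∑ j : Fin 3, ∫ y,
        fderiv ℝ (fun z : EuclideanSpace ℝ (Fin 3) => cutoff r z * z i) y (EuclideanSpace.single j 1) *
          stressTensor B A j.succ i.succ (ofTimeSpace t y))) ≤
      -ymEnergyAt A t + (1 + 90 * cutoffGradConst) * (∫ y, energyMajorant y) * r ^ (-(1 / 4 : ℝ)) := by
  have hrpos : 0 < r := by linarith
  rw [h.deriv_weightedMomentum_eq hrpos t]
  have hC := cutoffGradConst_spec.1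
  have hG := integral_energyMajorant_nonneg
  -- the shell terms
  have hshell : ∀ i j : Fin 3, |∫ y, (y i * fderiv ℝ (cutoff r) y (EuclideanSpace.single j 1)) *
      stressTensor B A j.succ i.succ (ofTimeSpace t y)| ≤
      (2 * cutoffGradConst) * ∫ y, 5 * (r ^ (-(1 / 4 : ℝ)) * energyMajorant y) := by
    intro i j
    refine abs_integral_mul_le_of_vanish (r := r) (by positivity)
      (fun y => abs_coord_mul_fderiv_cutoff_le hrpos i j y) (fun y hy => ?_)
      (fun y hy => h.abs_stressTensor_le_majorant hR₀ ht hr hy _ _) (fun y => by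
        have := energyMajorant_nonneg y; positivity)
      ((integrable_energyMajorant.const_mul _).const_mul _)
    rw [fderiv_cutoff_eq_zero_of_norm_lt hrpos hy]; simp
  have hS : |∑ i : Fin 3, ∑ j : Fin 3, ∫ y, (y i * fderiv ℝ (cutoff r) y (EuclideanSpace.single j 1)) *
      stressTensor B A j.succ i.succ (ofTimeSpace t y)| ≤
      90 * cutoffGradConst * (∫ y, energyMajorant y) * r ^ (-(1 / 4 : ℝ)) := by
    calc |∑ i : Fin 3, ∑ j : Fin 3, ∫ y, (y i * fderiv ℝ (cutoff r) y (EuclideanSpace.single j 1)) *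
          stressTensor B A j.succ i.succ (ofTimeSpace t y)|
        ≤ ∑ i : Fin 3, |∑ j : Fin 3, ∫ y, (y i * fderiv ℝ (cutoff r) y
            (EuclideanSpace.single j 1)) * stressTensor B A j.succ i.succ (ofTimeSpace t y)| :=
          Finset.abs_sum_le_sum_abs _ _
      _ ≤ ∑ i : Fin 3, ∑ j : Fin 3, |∫ y, (y i * fderiv ℝ (cutoff r) y
            (EuclideanSpace.single j 1)) * stressTensor B A j.succ i.succ (ofTimeSpace t y)| :=
          Finset.sum_le_sum fun i _ => Finset.abs_sum_le_sum_abs _ _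
      _ ≤ ∑ _i : Fin 3, ∑ _j : Fin 3,
            (2 * cutoffGradConst) * ∫ y, 5 * (r ^ (-(1 / 4 : ℝ)) * energyMajorant y) :=
          Finset.sum_le_sum fun i _ => Finset.sum_le_sum fun j _ => hshell i j
      _ = 90 * cutoffGradConst * (∫ y, energyMajorant y) * r ^ (-(1 / 4 : ℝ)) := by
          rw [integral_const_mul, integral_const_mul]
          simp only [Finset.sum_const, Finset.card_univ, Fintype.card_fin, nsmul_eq_mul,
            Nat.cast_ofNat]
          ring
  -- the bulk term
  have hbulk := (h.energy_sub_cutoffEnergy hR₀1 hR₀ ht hr).2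
  have hS' := (abs_le.1 hS).1
  nlinarith [hS', hbulk, hC, hG, Real.rpow_nonneg hrpos.le (-(1 / 4 : ℝ))]

/-- **(15): `|P(t)| ≤ 30 r E(t)`** (`|χ_r yⁱ| ≤ 2r` and `|θ_{0i}| ≤ 5 θ₀₀`).
[cite: Coleman1977, §2 (9), (15)] -/
theorem abs_weightedMomentum_le (h : ColemanHypotheses 𝔤 B A) {r : ℝ} (hr : 0 < r) (t : ℝ) :
    |∑ i : Fin 3, ∫ y, (cutoff r y * y i) * stressTensor B A 0 i.succ (ofTimeSpace t y)| ≤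
      30 * r * ymEnergyAt A t := by
  have hi : ∀ i : Fin 3, |∫ y, (cutoff r y * y i) * stressTensor B A 0 i.succ (ofTimeSpace t y)| ≤
      10 * r * ymEnergyAt A t := by
    intro i
    have hpt : ∀ y, ‖(cutoff r y * y i) * stressTensor B A 0 i.succ (ofTimeSpace t y)‖ ≤
        10 * r * ymEnergyDensity A (ofTimeSpace t y) := by
      intro y
      rw [Real.norm_eq_abs, abs_mul]
      have h1 := abs_cutoff_mul_coord_le hr i y
      have h2 := abs_stressTensor_le h.form 0 i.succ (A := A) (ofTimeSpace t y)
      have h3 := ymEnergyDensity_nonneg A (ofTimeSpace t y)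
      calc |cutoff r y * y i| * |stressTensor B A 0 i.succ (ofTimeSpace t y)|
          ≤ (2 * r) * (5 * ymEnergyDensity A (ofTimeSpace t y)) :=
            mul_le_mul h1 h2 (abs_nonneg _) (by positivity)
        _ = 10 * r * ymEnergyDensity A (ofTimeSpace t y) := by ring
    have := norm_integral_le_of_norm_le ((h.finiteEnergy t).const_mul (10 * r)) (ae_of_all _ hpt)
    rw [integral_const_mul, Real.norm_eq_abs] at this
    exact this
  calc |∑ i : Fin 3, ∫ y, (cutoff r y * y i) * stressTensor B A 0 i.succ (ofTimeSpace t y)|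
      ≤ ∑ i : Fin 3, |∫ y, (cutoff r y * y i) * stressTensor B A 0 i.succ (ofTimeSpace t y)| :=
        Finset.abs_sum_le_sum_abs _ _
    _ ≤ ∑ _i : Fin 3, 10 * r * ymEnergyAt A t := Finset.sum_le_sum fun i _ => hi i
    _ = 30 * r * ymEnergyAt A t := by
        simp only [Finset.sum_const, Finset.card_univ, Fintype.card_fin, nsmul_eq_mul,
          Nat.cast_ofNat]
        ring

/-! ### The energy vanishes at positive times -/

/-- **Coleman's theorem, energy form:** under Coleman's hypotheses the energy vanishes at all
positive times, `E(t) = 0` for `t > 0` — (13)–(15): if `E > 0`, then for `r` large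
`P'(t) ≤ −E/2` for all `t > 0` while `|P(t)| ≤ 30 r E`, which is impossible for `t` large.
[cite: Coleman1977, §2 (13)–(15)] -/
theorem ymEnergyAt_eq_zero (h : ColemanHypotheses 𝔤 B A) {t : ℝ} (ht : 0 < t) :
    ymEnergyAt A t = 0 := by
  obtain ⟨R₀, hR₀1, hR₀⟩ := h.exists_radius
  set E : ℝ := ymEnergyAt A 1 with hE
  have hconst : ∀ s : ℝ, 0 < s → ymEnergyAt A s = E := fun s hs => h.ymEnergyAt_eq hs one_pos
  rw [hconst t ht]
  have hE0 : 0 ≤ E := integral_nonneg fun y => ymEnergyDensity_nonneg A _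
  by_contra hne
  have hEpos : 0 < E := lt_of_le_of_ne hE0 (Ne.symm hne)
  -- choose the radius
  set K : ℝ := (1 + 90 * cutoffGradConst) * ∫ y, energyMajorant y with hK
  have hlim := tendsto_const_mul_rpow_neg_quarter K
  obtain ⟨r, hr⟩ := ((Filter.eventually_ge_atTop R₀).and
    ((tendsto_order.1 hlim).2 (E / 2) (by linarith))).exists
  obtain ⟨hrR, hrK⟩ := hr
  have hrpos : 0 < r := by linarith
  -- the function `P` and its derivative
  set P : ℝ → ℝ := fun s => ∑ i : Fin 3, ∫ y, (cutoff r y * y i) *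
    stressTensor B A 0 i.succ (ofTimeSpace s y) with hP
  have hPd : ∀ s, HasDerivAt P (∑ i : Fin 3, -(∑ j : Fin 3, ∫ y,
      fderiv ℝ (fun z : EuclideanSpace ℝ (Fin 3) => cutoff r z * z i) y (EuclideanSpace.single j 1) *
        stressTensor B A j.succ i.succ (ofTimeSpace s y))) s := fun s =>
    h.hasDerivAt_weightedMomentum hrpos s
  have hP' : ∀ s : ℝ, 0 < s → deriv P s ≤ -(E / 2) := by
    intro s hs
    rw [(hPd s).deriv]
    have h1 := h.deriv_weightedMomentum_le hR₀1 hR₀ hs hrR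
    rw [hconst s hs] at h1
    have h2 : (1 + 90 * cutoffGradConst) * (∫ y, energyMajorant y) * r ^ (-(1 / 4 : ℝ)) =
        K * r ^ (-(1 / 4 : ℝ)) := by rw [hK]
    linarith
  have hPb : ∀ s : ℝ, 0 < s → |P s| ≤ 30 * r * E := by
    intro s hs
    have := h.abs_weightedMomentum_le hrpos s
    rwa [hconst s hs] at this
  -- the mean value inequality on `[1, T]`
  set T : ℝ := 2 + 120 * r with hT
  have hdiff : Differentiable ℝ P := fun s => (hPd s).differentiableAt
  have hmv := (convex_Ici (1 : ℝ)).image_sub_le_mul_sub_of_deriv_le hdiff.continuous.continuousOn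
    (hdiff.differentiableOn) (fun s hs => hP' s (by
      rw [interior_Ici] at hs; exact lt_trans one_pos hs)) 1 Set.self_mem_Ici T
      (Set.mem_Ici.2 (by rw [hT]; linarith)) (by rw [hT]; linarith)
  have h1 := abs_le.1 (hPb 1 one_pos)
  have h2 := abs_le.1 (hPb T (by rw [hT]; linarith))
  rw [hT] at hmv h2
  nlinarith [h1.1, h1.2, h2.1, h2.2, hmv, hEpos, hrpos]

/-- Hence the energy density vanishes at positive times (`θ₀₀ ≥ 0` is continuous with zero
integral). [cite: Coleman1977, §2] -/
theorem ymEnergyDensity_eq_zero (h : ColemanHypotheses 𝔤 B A) {t : ℝ} (ht : 0 < t)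
    (y : EuclideanSpace ℝ (Fin 3)) : ymEnergyDensity A (ofTimeSpace t y) = 0 := by
  have hint : Integrable fun y => ymEnergyDensity A (ofTimeSpace t y) := h.finiteEnergy t
  have h0 : ∫ y, ymEnergyDensity A (ofTimeSpace t y) = 0 := h.ymEnergyAt_eq_zero ht
  have hae := (integral_eq_zero_iff_of_nonneg (fun y => ymEnergyDensity_nonneg A _) hint).1 h0
  have hcont : Continuous fun y : EuclideanSpace ℝ (Fin 3) => ymEnergyDensity A (ofTimeSpace t y) := by
    have he : (fun y : EuclideanSpace ℝ (Fin 3) => ymEnergyDensity A (ofTimeSpace t y)) =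
        fun y => stressTensor B A 0 0 (ofTimeSpace t y) :=
      funext fun y => (stressTensor_zero_zero h.form _).symm
    rw [he]
    exact (contDiff_stressTensor h.smooth 0 0).continuous.comp
      (contDiff_ofTimeSpace_right t (n := 0)).continuous
  have heq := (Continuous.ae_eq_iff_eq volume hcont continuous_const).1 hae
  exact congrFun heq y

/-- Hence every component `F_{μν}(t, y)` vanishes at positive times. [cite: Coleman1977, §2] -/
theorem fieldStrength_eq_zero (h : ColemanHypotheses 𝔤 B A) {t : ℝ} (ht : 0 < t)
    (y : EuclideanSpace ℝ (Fin 3)) (μ ν : Fin 4) : fieldStrength A μ ν (ofTimeSpace t y) = 0 := by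
  have hsum := sum_norm_sq_fieldStrength (A := A) (ofTimeSpace t y)
  rw [h.ymEnergyDensity_eq_zero ht y, mul_zero] at hsum
  have h1 := (Finset.sum_eq_zero_iff_of_nonneg fun κ _ =>
    Finset.sum_nonneg fun ρ _ => sq_nonneg _).1 hsum μ (Finset.mem_univ μ)
  have h2 := (Finset.sum_eq_zero_iff_of_nonneg fun ρ _ => sq_nonneg _).1 h1 ν (Finset.mem_univ ν)
  exact norm_eq_zero.1 (pow_eq_zero_iff two_ne_zero |>.1 h2)

/-- **Coleman's theorem (abstract form): "the only non-singular solution of the Yang–Mills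
equation for which the limit of Equation (10) is uniform in `t` for positive `t` is the vacuum
solution"** — under Coleman's hypotheses, `F_A(x)(u, v) = 0` at every point `x` with `x⁰ > 0`
and all `u, v` (bilinearity of `F_A(x)` for differentiable `A`). [cite: Coleman1977, §2 (10)–(15)] -/
theorem curvature_eq_zero (h : ColemanHypotheses 𝔤 B A) {x : SpaceTime 3} (hx : 0 < x 0)
    (u v : SpaceTime 3) : curvature A x u v = 0 := by
  have hx' : ofTimeSpace (x 0) (spaceC 3 x) = x := ofTimeSpace_apply_zero_spaceC x
  have hF : ∀ μ ν : Fin 4, curvature A x (unitVec μ) (unitVec ν) = 0 := by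
    intro μ ν
    have := h.fieldStrength_eq_zero hx (spaceC 3 x) μ ν
    rwa [fieldStrength, hx'] at this
  obtain ⟨Fb, hFb⟩ := exists_bilin_eq_curvature A ((h.smooth.differentiable (by simp)) x)
  have hu : u = ∑ μ : Fin 4, u μ • unitVec μ := by
    conv_lhs => rw [← (EuclideanSpace.basisFun (Fin 4) ℝ).sum_repr u]
    simp [unitVec]
  have hv : v = ∑ ν : Fin 4, v ν • unitVec ν := by
    conv_lhs => rw [← (EuclideanSpace.basisFun (Fin 4) ℝ).sum_repr v]
    simp [unitVec]
  rw [← hFb, hu, hv]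
  simp only [map_sum, map_smul, LinearMap.sum_apply, LinearMap.smul_apply, hFb, hF, smul_zero,
    Finset.sum_const_zero]

end ColemanHypotheses

/-! ### The compact case: `𝔲(N) ⊆ M_N(ℂ)` with the trace form -/

section Compact

open scoped Matrix Matrix.Norms.Frobenius

variable {N : ℕ}

/-- A classical glueball satisfies Coleman's hypotheses with `𝔤 = 𝔲(N)` and the real trace form
`⟨X, Y⟩ = Re tr(Xᴴ Y)` (`traceFormL`, `isInvariantForm_traceFormL`). [cite: Coleman1977, §1–2] -/
theorem IsClassicalGlueball.colemanHypotheses {A : Connection (SpaceTime 3) (Matrix (Fin N) (Fin N) ℂ)}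
    (hA : IsClassicalGlueball A) :
    ColemanHypotheses (skewAdjoint.submodule ℝ (Matrix (Fin N) (Fin N) ℂ)) traceFormL A :=
  ⟨isInvariantForm_traceFormL, hA.1, hA.2.1, hA.2.2.1, hA.2.2.2.1, hA.2.2.2.2.1⟩

/-- **Discharge of `ColemanNoClassicalGlueballs` (Coleman 1977, "There are no classical
glueballs"):** for every `N`, no `𝔲(N)`-valued connection on `ℝ^{1+3}` is a classical glueball —
a smooth finite-energy solution of the Yang–Mills equations obeying the no-radiation condition
(10) uniformly in `t > 0` has `F ≡ 0` at all positive times (`ColemanHypotheses.curvature_eq_zero`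
with the trace form), contradicting non-flatness at some `x⁰ > 0`.
[cite: Coleman1977, §2 (10)–(15)] -/
theorem ColemanNoClassicalGlueballs_holds : ColemanNoClassicalGlueballs := by
  intro N A hA
  obtain ⟨x, u, v, hx, hne⟩ := hA.2.2.2.2.2
  exact hne ((IsClassicalGlueball.colemanHypotheses hA).curvature_eq_zero hx u v)

end Compact

end Literature.Barriers.QuantumFields
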